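import Summits.BirchSwinnertonDyer.Rank1Residual.Additive.X4RankZeroKatoBoundTamagawaExact
import Summits.BirchSwinnertonDyer.Rank1Residual.Additive.X4RankZeroLowerCertificate
import Summits.BirchSwinnertonDyer.Rank1Residual.Supersingular.TowerSurjectivityOfRam
import Summits.BirchSwinnertonDyer.Rank1Residual.Additive.X4SharpThreeAssemblyManinFree
import HarnessLib
import HarnessLib.Audit.Tags

/-!
# X4 ∧ `r_an = 0`: `BSD(E,p)` from ONE element of `Sel^(p)(E/ℚ)` — the `p`-descent-fed `_of_katoTam` / `_maninFree` ENDs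
# (T-O6-LB3 composition TOOL; o6-r1 GEN 28 REDIRECT for the X4 r0 sub-classes B / C of class O6; cell `b2b-bsdres`)

HONEST FRAMING (cell `b2b-bsdres`, run/shared/lean/b2b/bsd-rank1-residual/, verbatim in every
file): the goal of the cell is to DELETE the COMBINATION-SHAPED residual classes of the
Birch–Swinnerton-Dyer formula for ALL analytic-rank `≤ 1` elliptic curves over `ℚ` — "full BSD
formula for every rank `≤ 1` curve in class `C`" assembled STRICTLY from published theorems — so
that the rank-`≤ 1` remainder becomes exactly the CONSTRUCTION-SHAPED classes, which are TYPED
(missing-input `Prop`s), NOT attempted. This is not "finishing BSD". Lane CLASS-CLOSURE §3.4 O6 /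
sub-cell X4 r0: research route on the CONSTRUCTION-SHAPED class X4; this file is a composition TOOL of
tree theorems — PER-PAIR certificate consumers, not a class theorem; a pair closes only when a per-row
record lands with its binders displayed and discharged AS TYPED (n1011 R5-194); descent elements /
EXACT-GRH certificates (x11c, sha-2) are COMPUTATION = EVIDENCE, never a Literature fact; the labels
X4 / O6 are UNCHANGED; nothing is booked; no mark of `RESIDUAL-MAP.md` moves. THEOREMS ONLY (no
definition, no named fact minted, no `@[conjecture]` node, no `sorry`; every published input is an
explicit named-fact hypothesis: A161″ `hKatoTam` / A161′ via `hKatoω`, A24 `hCT`, `hGZK`, modularity).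

## What this file proves (o6-r1 GEN 28's description of its scratch, verbatim)

The one missing TOOL composing three tree theorems:
* `X4RankZero.bsdp_of_missingLowerBoundAt_of_katoTam` (n1011-p04 FILE 6, p323037; fact A161″
  `Kato2004.rankZero_padicValNat_sha_add_padicValNat_tamagawa_le_of_additive_potGood_of_imageContainsSL2`,
  lit-kato p320328) — the UPPER half with NO Tamagawa / Manin / parity binder;
* `Supersingular.missingLowerBoundAt_of_casselsTate_of_selmerGroup_ne_bot` (additive-p4) — the LOWER
  half `p² ∣ #Ш` from `Sel^(p)(E/ℚ) ≠ 0`, rank 0, no rational `p`-torsion (from irreducibility), CT;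
* `towerSurj_three_of_surj_of_jWitness_or_nine` / `Supersingular.towerSurj_of_surj_of_ram` — the tower.

Customers: every X4 ∧ r_an = 0 ∧ p = 3 row with `9 ∥ #Ш_an` (or `3 ∥`-impossible / unit rows too) and
ONE exhibited element of `Sel^(3)(E/ℚ)` — x11c GEN 15 `X4-LOWER3-TABLE.md`: 7 385 rows, two exact
elements each; O6 (v₃(N) ≥ 3): B 1 277 + C 329 rows, all covered. EVIDENCE seat: this file only shows
the composition elaborates; filing is a typer's / records seat's (LEAN PLACEMENT RULE: under
`Summits/BirchSwinnertonDyer/Rank1Residual/Additive/` or `/O6/`).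

## TYPER PLACEMENT NOTE (cc-typer-5 GEN 18 = O5 §3.5 / O6 §3.4 typer of record; (L1) of o6-r1 GEN 28 REDIRECT HOME/INBOX.md l.13948,
n1011 R5-194 l.13955 (precedence o6-r2 / cc-typer-5 / additive-p4 to 2026-08-23T06:00Z), cc-lead GEN 75 l.14001 (placement view), typer word + MINE l.14111)

Source: `HOME/b2b-bsdres-o6-r1/gen28/lb3/LB3ToolScratch.lean` sha16 `d702d7fe7966d1d8` (104 l.; o6-r1's `lean check --json` rc 0 / 0 errors / 0 warnings /
0 sorry), re-hashed by the typer right before writing.  THIS file = the scratch's imports, `open`s, `variable` line and its FOUR theorem blocks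
(`X4RankZero.bsdp_of_katoTam_of_selmerGroup_ne_bot`, `X4RankZero.bsdp_three_of_katoTam_of_surj_of_cert_of_selmerGroup_ne_bot`,
`X4RankZero.bsdp_three_of_katoTam_of_surj_of_ram_of_selmerGroup_ne_bot`, `X4RankZero.bsdp_three_of_cert_of_selmerGroup_ne_bot_maninFree`) BYTE-IDENTICAL
(script `class-closure/typer-5/gen18/l1_place.py`); only the scratch's module-docstring TITLE ('SCRATCH … NOT a proposal') is replaced by the tree title +
the cell's HONEST FRAMING paragraph above, the scratch's own prose kept verbatim under 'What this file proves'.  PLACEMENT = `Additive/` (directory =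
the declared namespace `…Rank1Residual.Additive`, a member of the `Additive/X4RankZero*` assembly family next to `X4RankZeroLowerCertificate.lean`
whose `MissingLowerBoundAt` input it replaces by a Selmer ELEMENT; cc-lead GEN 77 CONCUR l.14166; n1011 lead gen 13 R5-201 l.14124 ADOPTED).  Farm: the typer's check rc 0 / 0 warnings; axioms of all four theorems {propext, Classical.choice,
Quot.sound}; DEDUP `lean search --decl` on the four names: no match.  Customers (per o6-r1): the (L2) per-row records `bsdp3_l<label>` (x11c /
n1011 hands) feed `hSel : W.selmerGroup 3 ≠ ⊥` from two-engine descent ELEMENTS; the token T-KATO-LB3 is referee A's (L4).  Nothing booked; O6 OPEN.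
-/

open scoped Classical

namespace Summit.BirchSwinnertonDyer.Rank1Residual.Additive

open WeierstrassCurve Literature.NumberTheory.EllipticCurves
  Literature.NumberTheory.EllipticCurves.ModularForms
  Literature.NumberTheory.EllipticCurves.Rank1Residual
  Literature.NumberTheory.EllipticCurves.Rank1Residual.Typed

variable (W : WeierstrassCurve ℚ) [W.IsElliptic] [W.IsGloballyMinimal] (p : ℕ) [Fact p.Prime]

/-- **`BSD(E,p)` from ONE element of `Sel^(p)(E/ℚ)`, no Tamagawa / Manin price** (any prime `p`):
X4 ∧ `r_an = 0` ∧ `ord_p j ≥ 0` ∧ tower onto ∧ `#Ш_an = q`, `ord_p q ≤ 2` ∧ `Sel^(p)(E/ℚ) ≠ 0`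
⟹ `BSD(E,p)`. -/
theorem X4RankZero.bsdp_of_katoTam_of_selmerGroup_ne_bot
    (hKatoT : Kato2004.rankZero_padicValNat_sha_add_padicValNat_tamagawa_le_of_additive_potGood_of_imageContainsSL2)
    (hCT : exists_casselsTate_pairing (K := ℚ))
    (hGZK : rank_eq_analyticRank_of_analyticRank_le_one) (hmod : hasEntireLFunction_rat)
    (hr : W.analyticRank = 0) (hX : ClassX4 W p) (hpot : 0 ≤ padicValRat p W.j)
    (hsurj : ∀ n : ℕ, W.HasSurjectiveModNGaloisRep (p ^ n : ℕ))
    {q : ℚ} (hq : shaAn W = (q : ℂ)) (hv : padicValRat p q ≤ 2)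
    (hSel : W.selmerGroup (p : ℤ) ≠ ⊥) : BSDp W p :=
  X4RankZero.bsdp_of_missingLowerBoundAt_of_katoTam W p hKatoT hGZK hmod hr hX hpot hsurj
    (Supersingular.missingLowerBoundAt_of_casselsTate_of_selmerGroup_ne_bot W p hCT hGZK hr
      (Supersingular.not_dvd_torsionOrder_of_irr W p hX.2.2) hq hv hSel)

/-- **`p = 3` census shape, tower from a `j`-witness or surj(9).** -/
theorem X4RankZero.bsdp_three_of_katoTam_of_surj_of_cert_of_selmerGroup_ne_bot
    (hKatoT : Kato2004.rankZero_padicValNat_sha_add_padicValNat_tamagawa_le_of_additive_potGood_of_imageContainsSL2)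
    (hCT : exists_casselsTate_pairing (K := ℚ))
    (hGZK : rank_eq_analyticRank_of_analyticRank_le_one) (hmod : hasEntireLFunction_rat)
    (hr : W.analyticRank = 0) (hX : ClassX4 W 3) (hpot : 0 ≤ padicValRat 3 W.j) (hsurj : Surj W 3)
    (hcert : (∃ q : ℕ, q.Prime ∧ q ≠ 3 ∧ padicValRat q W.j < 0 ∧ ¬ (3 : ℤ) ∣ padicValRat q W.j) ∨
      W.HasSurjectiveModNGaloisRep 9)
    {q : ℚ} (hq : shaAn W = (q : ℂ)) (hv : padicValRat 3 q ≤ 2)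
    (hSel : W.selmerGroup (3 : ℤ) ≠ ⊥) : BSDp W 3 :=
  X4RankZero.bsdp_of_katoTam_of_selmerGroup_ne_bot W 3 hKatoT hCT hGZK hmod hr hX hpot
    (towerSurj_three_of_surj_of_jWitness_or_nine W hsurj hcert) hq hv hSel

/-- **`p = 3` census shape, tower from surj(3) ∧ ram(3)** (a multiplicative `ℓ ≠ 3` with
`3 ∤ v_ℓ(Δ_min)`; `Supersingular.towerSurj_of_surj_of_ram`). -/
theorem X4RankZero.bsdp_three_of_katoTam_of_surj_of_ram_of_selmerGroup_ne_bot
    (hKatoT : Kato2004.rankZero_padicValNat_sha_add_padicValNat_tamagawa_le_of_additive_potGood_of_imageContainsSL2)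
    (hCT : exists_casselsTate_pairing (K := ℚ))
    (hGZK : rank_eq_analyticRank_of_analyticRank_le_one) (hmod : hasEntireLFunction_rat)
    (hr : W.analyticRank = 0) (hX : ClassX4 W 3) (hpot : 0 ≤ padicValRat 3 W.j) (hsurj : Surj W 3)
    (hram : Ram W 3)
    {q : ℚ} (hq : shaAn W = (q : ℂ)) (hv : padicValRat 3 q ≤ 2)
    (hSel : W.selmerGroup (3 : ℤ) ≠ ⊥) : BSDp W 3 :=
  X4RankZero.bsdp_of_katoTam_of_selmerGroup_ne_bot W 3 hKatoT hCT hGZK hmod hr hX hpot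
    (Supersingular.towerSurj_of_surj_of_ram W 3 hsurj hram) hq hv hSel

/-- **B-row END with LANE-BOOKED facts only** (A161′ Manin-free Kato, R198.11; A24 Cassels–Tate; PMX
facts R198.7 ride along unused on the pot-good branch; GZK; modularity): X4 ∧ `r_an = 0` ∧ surj(3) ∧
[`ord₃ j < 0` ∨ `j`-witness ∨ surj(9)] ∧ `3 ∤ ∏ c_ℓ` ∧ `#Ш_an = q`, `ord₃ q ≤ 2` ∧ `Sel^(3)(E/ℚ) ≠ 0`
⟹ `BSD(E,3)` — composition of additive-p4's `X4RankZero.bsdp_three_of_cert_of_lower_maninFree` with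
`Supersingular.missingLowerBoundAt_of_casselsTate_of_selmerGroup_ne_bot`. -/
theorem X4RankZero.bsdp_three_of_cert_of_selmerGroup_ne_bot_maninFree
    (hKato : Kato2004.rankZero_padicValNat_sha_le_sub_localTamagawa_of_additive_potGood_of_imageContainsSL2_maninFree)
    (hDel : Delbourgo1998.prop4_rankZero_pow_dvd_constantCoeff)
    (hGZK : rank_eq_analyticRank_of_analyticRank_le_one) (hmod : hasEntireLFunction_rat)
    (hmodD : nonempty_modularParametrizationData)
    (hL20 : Wuthrich2014.lemma20_surjective_threeAdic_of_semistable)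
    (hKatoω : Wuthrich2014.kato_minusEigenCharIdeal_dvd_cyclotomicThree_of_surjective)
    (hCT : exists_casselsTate_pairing (K := ℚ))
    (hr : W.analyticRank = 0) (hX : ClassX4 W 3) (hsurj : Surj W 3)
    (hcert : padicValRat 3 W.j < 0 ∨
      (∃ q : ℕ, q.Prime ∧ q ≠ 3 ∧ padicValRat q W.j < 0 ∧ ¬ (3 : ℤ) ∣ padicValRat q W.j) ∨
        W.HasSurjectiveModNGaloisRep 9)
    (htam : ¬ 3 ∣ W.tamagawaProduct)
    {q : ℚ} (hq : shaAn W = (q : ℂ)) (hv : padicValRat 3 q ≤ 2)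
    (hSel : W.selmerGroup (3 : ℤ) ≠ ⊥) : BSDp W 3 :=
  haveI : Fact (Nat.Prime 3) := ⟨Nat.prime_three⟩
  X4RankZero.bsdp_three_of_cert_of_lower_maninFree W hKato hDel hGZK hmod hmodD hL20 hKatoω hr hX hsurj
    hcert htam
    (Supersingular.missingLowerBoundAt_of_casselsTate_of_selmerGroup_ne_bot W 3 hCT hGZK hr
      (Supersingular.not_dvd_torsionOrder_of_irr W 3 hX.2.2) hq hv hSel)

end Summit.BirchSwinnertonDyer.Rank1Residual.Additive

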